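import Summits.BirchSwinnertonDyer.BirchSwinnertonDyer.Theorems.ByReductionTypeAtTwoGoodOrdTowerEpsStep
import Summits.BirchSwinnertonDyer.Rank1Residual.F1Sign2.LocalKernelSymbolLawAtTwo
import HarnessLib

/-!
# Route `ByReductionTypeAtTwo`, item `OrdKatoHalfAtTwo` (stmt-BirchSwinnertonDyer-19271), TOWER road: the GOOD-ORDINARY
# local constant at `v ∣ 2` is ONE BIT when `Δ_min ≡ ±3 (mod 8)` — `#𝒦_{v,n}[2^∞][2] ≤ 2` as a KERNEL THEOREM, and
# cell `bsd-f1-sign2`'s IMC-LKε⁻≤ (`F1Sign2.LocalKernelOneBitOffNormAtTwoLe`) PROVED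

HONEST FRAMING (cell `bsd-2adic`, run/shared/lean/pub/bsd-2adic/, seat `bsd-2adic-tower-1` GEN 18, HUMAN RULINGS
D-0036 / D-0054 / D-0074; wake item «IMC-LKε kernelisation», planner RC-201 on director-bsd g12 2026-08-28T02:33:53Z,
HOME/plan/WAKE-IDLE-2ADIC-IMC-LKeps-kernelisation.md; cell `bsd-f1-sign2` MEMO-imc §10.35/§10.45/§10.46): TOOL theorems only
(no definition, no named fact, no `sorry`); closes no item by itself; nothing is booked; BSD is not proved by any of this.
WHAT IT DOES: the GEN 11 kernel theorem `GoodOrdTower.pTorsion_localTowerKer_at_two_le_four_kernel` (`#𝒦_{v,n}[2^∞][2] ≤ 4`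
at a good ordinary `2`, every layer) is REFINED to `≤ 2` under `Δ_W ≡ ±3 (mod 8)`; this is the statement
`F1Sign2.LocalKernelOneBitOffNormAtTwoLe` (tree p599820, the ≤-form of IMC-LKε⁻, p591873) consumed by the ε-door
`C₂ = 2` at `v ∋ 2` of 71 good-ordinary X5 classes of 19271's regime (MEMO-imc §10.37, §10.43), now a theorem with NO binder.

THE PROOF = the GEN 11 assembly with ONE change: in the dévissage `#𝒦_{v,n}[2] ≤ #(M/(g−1)M)[2] ≤ #(M₁/(g−1)M₁)[2] · #Ẽ(k̄)[2]`
(`M = E(K̄_v)^{H_∞}`, `M₁ = M ∩ Ê`, `g` an inertial topological generator) the étale factor is NOT REALISED: by BRICK ε4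
(`localRed_eq_zero_of_two_nsmul_eq_smul_sub`, the ε-step) every `2`-torsion class of `M/(g−1)M` reduces to `0`, so the refined
dévissage `natCard_torsionBy_quotient_le_of_invariant_of_red_eq_zero` (cell `bsd-f1-sign2`'s kernel-checked interface
`MEMO-imc-data/SketchG5-EpsInterface.lean` §1, re-proved here) gives `#(M/(g−1)M)[2] ≤ #(M₁/(g−1)M₁)[2] ≤ 2` (G3+G5+G6c as in GEN 11).

* `natCard_torsionBy_quotient_le_of_invariant_of_red_eq_zero` — the ε-refined dévissage (pure algebra).
* **`pTorsion_localTowerKer_at_two_le_two_kernel_of_discNonNorm`** — for `W/ℚ` globally minimal, good ordinary at `2`, with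
  `Δ_W ≡ ±3 (mod 8)` (`F1Sign2.DiscNonNormFromFirstLayerAtTwo W`), `κ` cyclotomic, `v ∋ 2`, every `n`:
  `𝒦_{v,n}[2^∞][2]` is finite with AT MOST `2` elements (the signature of cell `bsd-f1-sign2`'s generator mode
  `--binder kernel:<FqTheorem>`, MEMO-imc §10.45 addendum).
* **`localKernelOneBitOffNormAtTwoLe_holds : F1Sign2.LocalKernelOneBitOffNormAtTwoLe`** — IMC-LKε⁻≤ PROVED.

References: R. Greenberg, LNM 1716 (1999), §2 Props. 2.2–2.5, §3 Lemma 3.4 (p. 89); K. Kramer, Trans. AMS 264 (1981) Prop. 5;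
J. Silverman, *AEC* (2009), VII.2.1, VII.6.3; J.-P. Serre, *Galois Cohomology* II §5.7, *Local Fields* X §1; J. Neukirch, *ANT*
V (1.1); scope memos HOME/tower/SCOPE-hS34-layer-kernel-at-2-GEN7.md, pub/bsd-f1-sign2/MEMO-imc-data/SCOPE-IMC-LKeps-kernel-g5.md.
-/

set_option autoImplicit false
-- the Theorems namespace of this sub repeats the summit name by design (D-0017 nested layout: Summit.<S>.<Sub>)
set_option linter.dupNamespace false

noncomputable section

open scoped Classical NNReal

universe u v

namespace Summit.BirchSwinnertonDyer.BirchSwinnertonDyer.Theorems.GoodOrdTower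

/-! ### The ε-refined dévissage -/

section Abstract

variable {M : Type u} {M₁ : Type u} {T : Type v} [AddCommGroup M] [AddCommGroup M₁] [AddCommGroup T]

/-- **ε-refined dévissage.** In the setting of `natCard_torsionBy_quotient_le_of_invariant` (`D = g − 1` on `M`,
`r : M → T` with invariant lifts, `j : M₁ ↪ M` onto `ker r`, `D₁ = D|_{M₁}`), suppose moreover that every `p`-torsion
class of `M/DM` reduces to zero: `p • x = D y ⇒ r x = 0` (`hε`). Then the `p`-torsion of `M/DM` is finite and
`#(M/D M)[p] ≤ #(M₁/D₁ M₁)[p]` — the factor `#T[p]` of the unrefined lemma is not realised. (Kernel-checked first by cell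
`bsd-f1-sign2`, seat `-imc` g5, `MEMO-imc-data/SketchG5-EpsInterface.lean` §1; re-proved here so that it lives in the tree.)
[cite: GreenbergLNM1716, §3 Lemma 3.4 (proof, p. 89)] -/
theorem natCard_torsionBy_quotient_le_of_invariant_of_red_eq_zero (D : M →+ M) (r : M →+ T)
    (hlift : ∀ x : M, ∃ x₀ : M, D x₀ = 0 ∧ r x₀ = r x)
    (j : M₁ →+ M) (hj : Function.Injective j) (hrj : ∀ y, r y = 0 → ∃ x, j x = y)
    (D₁ : M₁ →+ M₁) (hD₁ : ∀ x, j (D₁ x) = D (j x)) (p : ℕ)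
    (hε : ∀ x y : M, p • x = D y → r x = 0)
    [Finite {c : M₁ ⧸ D₁.range // p • c = 0}] :
    Finite {c : M ⧸ D.range // p • c = 0} ∧
      Nat.card {c : M ⧸ D.range // p • c = 0} ≤ Nat.card {c : M₁ ⧸ D₁.range // p • c = 0} := by
  let Q := M ⧸ D.range
  let Q₁ := M₁ ⧸ D₁.range
  -- the map `M₁/D₁M₁ → M/DM` induced by `j`
  have hle₁ : D₁.range ≤ D.range.comap j := by
    rintro _ ⟨x, rfl⟩
    exact ⟨j x, (hD₁ x).symm⟩
  let ι : Q₁ →+ Q := QuotientAddGroup.map D₁.range D.range j hle₁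
  have hι : ∀ x : M₁, ι (QuotientAddGroup.mk x) = QuotientAddGroup.mk (j x) := fun x ↦
    QuotientAddGroup.map_mk' _ _ _ _ x
  let P : AddSubgroup Q := AddSubgroup.torsionBy Q (p : ℤ)
  have hP : ∀ c : Q, c ∈ P ↔ p • c = 0 := fun c ↦ AddSubgroup.torsionBy.nsmul_iff
  let P₁ : AddSubgroup Q₁ := AddSubgroup.torsionBy Q₁ (p : ℤ)
  have hP₁ : ∀ c : Q₁, c ∈ P₁ ↔ p • c = 0 := fun c ↦ AddSubgroup.torsionBy.nsmul_iff
  haveI hP₁fin : Finite P₁ :=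
    Finite.of_equiv _ (Equiv.subtypeEquivRight fun c ↦ (hP₁ c).symm)
  -- every `p`-torsion class `[x]` has `r x = 0` (by `hε`), hence is the image of a `p`-torsion class of `M₁/D₁M₁`
  have hmem : ∀ k : P, ∃ x : M₁, ι (QuotientAddGroup.mk x) = ((k : Q)) ∧ (QuotientAddGroup.mk x : Q₁) ∈ P₁ := by
    intro k
    obtain ⟨x, hx⟩ := QuotientAddGroup.mk_surjective (k : Q)
    have hpx : (p • QuotientAddGroup.mk x : Q) = 0 := by rw [hx]; exact (hP _).mp k.2
    rw [← QuotientAddGroup.mk_nsmul, QuotientAddGroup.eq_zero_iff] at hpx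
    obtain ⟨y, hy⟩ := hpx
    have hrx : r x = 0 := hε x y hy.symm
    obtain ⟨x₁, rfl⟩ := hrj x hrx
    obtain ⟨y₀, hDy₀, hry₀⟩ := hlift y
    obtain ⟨y₁, hy₁⟩ := hrj (y - y₀) (by rw [map_sub, hry₀, sub_self])
    refine ⟨x₁, by rw [hι, hx], ?_⟩
    rw [hP₁, ← QuotientAddGroup.mk_nsmul, QuotientAddGroup.eq_zero_iff]
    refine ⟨y₁, hj ?_⟩
    rw [hD₁, hy₁, map_sub, hDy₀, sub_zero, hy, map_nsmul]
  let ψ : P → P₁ := fun k ↦ ⟨QuotientAddGroup.mk (hmem k).choose, (hmem k).choose_spec.2⟩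
  have hψ : Function.Injective ψ := by
    intro k k' h
    have h1 : (QuotientAddGroup.mk (hmem k).choose : Q₁) = QuotientAddGroup.mk (hmem k').choose :=
      congrArg Subtype.val h
    have h2 : ((k : Q)) = ((k' : Q)) := by
      rw [← (hmem k).choose_spec.1, ← (hmem k').choose_spec.1, h1]
    exact Subtype.ext h2
  haveI hPfin : Finite P := Finite.of_injective ψ hψ
  have hcard : Nat.card P ≤ Nat.card P₁ := Nat.card_le_card_of_injective ψ hψ
  have e : Nat.card {c : Q // p • c = 0} = Nat.card P :=
    Nat.card_congr (Equiv.subtypeEquivRight fun c ↦ (hP c).symm)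
  have e₁ : Nat.card {c : Q₁ // p • c = 0} = Nat.card P₁ :=
    Nat.card_congr (Equiv.subtypeEquivRight fun c ↦ (hP₁ c).symm)
  refine ⟨Finite.of_equiv _ (Equiv.subtypeEquivRight fun c ↦ hP c), ?_⟩
  rw [e, e₁]
  exact hcard

end Abstract

/-! ### `#𝒦_{v,n}[2^∞][2] ≤ 2` at a good ordinary `2` with `Δ ≡ ±3 (mod 8)` -/

open NumberField IsDedekindDomain Field Literature.NumberTheory.EllipticCurves
  Literature.NumberTheory.GaloisRepresentations IsDedekindDomain.HeightOneSpectrum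
  Literature.NumberTheory.EllipticCurves.FormalGroupChart Literature.NumberTheory.EllipticCurves.ResKernel
  Literature.NumberTheory.EllipticCurves.Rank1Residual WeierstrassCurve
  Summit.BirchSwinnertonDyer.Rank1Residual.F1Sign2

set_option maxHeartbeats 1600000 in
/-- **`#𝒦_{v,n}[2^∞][2] ≤ 2` at a good ORDINARY `2` with `Δ_W ≡ ±3 (mod 8)`, as a KERNEL THEOREM** (no print binder,
no named fact): for `W/ℚ` globally minimal, good ordinary at `2`, with `Δ_W = m`, `m ≡ 3, 5 (mod 8)`, the cyclotomic
`ℤ₂`-extension `κ`, a place `v ∣ 2` and a layer `n`, the `2`-torsion of the local tower kernel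
`𝒦_{v,n}[2^∞] = ker(H¹(H_{v,n}, E(K̄_v)) → H¹(H_{v,∞}, E(K̄_v)))[2^∞]` is finite of order at most `2`. Proof = the GEN 11 assembly
`pTorsion_localTowerKer_at_two_le_four_kernel` (BRICK 11, G1, G3, G5, G6c) with the dévissage G1 replaced by its ε-refinement
(`natCard_torsionBy_quotient_le_of_invariant_of_red_eq_zero`), whose hypothesis `hε` is BRICK ε4
`localRed_eq_zero_of_two_nsmul_eq_smul_sub` (the ε-step at every layer). Twin of the NS2 one-bit law
`MultTowerNS2.localTowerKerTwoTorsion_le_two_nonsplitTwo_of_tateUnit_holds` (unit `Δ_min` instead of the Tate unit).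
[cite: GreenbergLNM1716, §2 Prop. 2.5, §3 Lemma 3.4 (p. 89)] [cite: Kramer1981, §2 Prop. 5 (p. 127)]
[cite: SilvermanAEC2009, VII.2.1, VII.6.3] [cite: NeukirchANT1999, Ch. V §1 Thm. (1.1)] -/
theorem pTorsion_localTowerKer_at_two_le_two_kernel_of_discNonNorm (W : WeierstrassCurve ℚ) [W.IsGloballyMinimal]
    [W.IsElliptic] (hgo : GoodOrd W 2) (hΔ8 : DiscNonNormFromFirstLayerAtTwo W) (κ : ZpExtension ℚ 2) (hκ : κ.IsCyclotomic)
    (v : HeightOneSpectrum (𝓞 ℚ)) (h2v : ((2 : ℕ) : 𝓞 ℚ) ∈ v.asIdeal) (n : ℕ) :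
    Finite {x : W.localTowerKerPrimary κ (v.adicCompletion ℚ) n // 2 • x = 0} ∧
      Nat.card {x : W.localTowerKerPrimary κ (v.adicCompletion ℚ) n // 2 • x = 0} ≤ 2 := by
  haveI : Fact (Nat.Prime 2) := ⟨Nat.prime_two⟩
  have hΔ8' : ∃ m : ℤ, (m : ℚ) = W.Δ ∧ (m % 8 = 3 ∨ m % 8 = 5) := hΔ8
  have hord : W.HasGoodReductionAtPrime 2 ∧ ¬ ((2 : ℕ) : ℤ) ∣ W.frobeniusTrace 2 := hgo
  have hΔ : ¬ ((2 : ℕ) : ℤ) ∣ minimalDiscriminantInt W :=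
    W.not_dvd_minimalDiscriminantInt_of_hasGoodReductionAtPrime' 2 hord.1
  have hap := hord.2
  -- the spectral valuation, the model, the reduction map (as in `pTorsion_localTowerKer_at_two_le_four_kernel`)
  obtain ⟨w, hw⟩ := v.exists_spectralValuation
  have hvO : w.Integers w.valuationSubring := Valuation.valuationSubring.integers w
  have hΔu := W.isUnit_Δ_localIntModel h2v hw hΔ
  let red₀ : localPoints W (v.adicCompletion ℚ) →+
      (((integralModelInt W).map (algebraMap ℤ ↥w.valuationSubring)).map
        (IsLocalRing.residue ↥w.valuationSubring)).toAffine.Point :=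
    (goodReductionHom _ hvO hΔu).comp
      (Affine.Point.congrEquiv (localIntModel_baseChange W w.valuationSubring).symm).toAddMonoidHom
  have hred₀ : ∀ P : localPoints W (v.adicCompletion ℚ), red₀ P =
      ((integralModelInt W).map (algebraMap ℤ ↥w.valuationSubring)).reducePoint
        (Affine.Point.congrEquiv (localIntModel_baseChange W w.valuationSubring).symm P) :=
    fun P ↦ rfl
  have hpO : w ((2 : ℕ) : AlgebraicClosure (v.adicCompletion ℚ)) < 1 := by
    have h := spectralValuation_algebraMap_ringOfIntegers_lt_one (v := v) hw h2v
    rwa [map_natCast] at h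
  haveI hchar : CharP (IsLocalRing.ResidueField ↥w.valuationSubring) 2 := by
    refine (CharP.charP_iff_prime_eq_zero Nat.prime_two).mpr ?_
    rw [← map_natCast (IsLocalRing.residue ↥w.valuationSubring), IsLocalRing.residue_eq_zero_iff,
      IsLocalRing.mem_maximalIdeal, mem_nonunits_iff, hvO.isUnit_iff_valuation_eq_one, map_natCast]
    exact ne_of_lt hpO
  haveI hV : (W.baseChange (AlgebraicClosure (v.adicCompletion ℚ))).IsIntegral w.integer :=
    ⟨⟨(integralModelInt W).map (algebraMap ℤ ↥w.integer), W.baseChange_eq_localIntModel_integer_baseChange⟩⟩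
  -- the Frobenius inside `H_∞`
  obtain ⟨𝔐, h𝔐⟩ := v.localPrimesAbove_nonempty
  have hϖ : Irreducible ((2 : ℕ) : v.adicCompletionIntegers ℚ) := irreducible_natCast_adicCompletionIntegers_rat h2v
  obtain ⟨τ, hτ, hτfix⟩ := exists_isArithFrobAt_forall_smul_eq hw h𝔐 h2v hϖ
  have hτHi : τ ∈ localSubgroup κ.kerSubgroup (v.adicCompletion ℚ) :=
    (mem_localSubgroup_iff _ _ τ).mpr (resGal_mem_kerSubgroup_of_forall_smul_rootOfUnity_eq hκ hτfix)
  -- the ordinary filtration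
  have hordA := W.exists_zsmul_eq_zero_localRed_ne_zero hw hΔu red₀ hred₀ h2v hΔ hap
  obtain ⟨hgenr, -, hdiv₁⟩ := W.localRed_ordinary_filtration hΔu red₀ hred₀ hordA
  obtain ⟨P₁, hP₁0, hP₁ord, hP₁gen⟩ := hgenr 1
  rw [pow_one] at hP₁ord hP₁gen
  have hP₁two : 2 • P₁ = 0 := by rw [← hP₁ord]; exact addOrderOf_nsmul_eq_zero P₁
  have hP₁ne : P₁ ≠ 0 := fun h ↦ by
    rw [h, addOrderOf_zero] at hP₁ord; exact absurd hP₁ord (by norm_num)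
  have hstab : ∀ (σ : absoluteGaloisGroup (v.adicCompletion ℚ)) (Q : localPoints W (v.adicCompletion ℚ)),
      red₀ Q = 0 → red₀ (σ • Q) = 0 :=
    fun σ Q hQ ↦ (W.localRed_smul_eq_zero_iff hw hΔu red₀ hred₀ σ Q).mpr hQ
  -- `A₁[2] = {0, P₁}` and `P₁` is rational
  have hA12 : ∀ a : localPoints W (v.adicCompletion ℚ), red₀ a = 0 → 2 • a = 0 → a = 0 ∨ a = P₁ := by
    intro a ha h2a
    obtain ⟨c, rfl⟩ := hP₁gen a ha (by rw [natCast_zsmul]; exact h2a)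
    rcases Nat.even_or_odd c with ⟨k, rfl⟩ | ⟨k, rfl⟩
    · left; rw [← two_mul, mul_comm, mul_nsmul', hP₁two, nsmul_zero]
    · right; rw [add_nsmul, mul_comm, mul_nsmul', hP₁two, nsmul_zero, zero_add, one_nsmul]
  have hP₁fix : ∀ σ : absoluteGaloisGroup (v.adicCompletion ℚ), σ • P₁ = P₁ := fun σ ↦ by
    rcases hA12 (σ • P₁) (hstab σ P₁ hP₁0) (by rw [← smul_comm, hP₁two, smul_zero]) with h | h
    · exact absurd (smul_eq_zero_iff_eq σ |>.mp h) hP₁ne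
    · exact h
  -- the groups: `H_∞ ⊴ H_n`, an inertial topological generator `g`
  haveI hHiN : (localSubgroup κ.kerSubgroup (v.adicCompletion ℚ)).Normal := by
    rw [localSubgroup_eq_comap]; exact Subgroup.Normal.comap inferInstance _
  obtain ⟨g, hgI, hgn, hgen⟩ := exists_inertial_generator hκ v h2v n
  have hgred : ∀ Q : (localPoints W (v.adicCompletion ℚ)), red₀ (g • Q) = red₀ Q := fun Q ↦
    localRed_smul_eq_of_mem_absInertia W hw red₀ hred₀ h2v h𝔐 hgI Q
  -- `A₁ = ker red₀`, `M₁ = A₁^{H_∞}`, `Aₙ = A₁^{H_n}`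
  let M₁s : AddSubgroup (localPoints W (v.adicCompletion ℚ)) := red₀.ker ⊓ FixedPoints.addSubgroup (localSubgroup κ.kerSubgroup (v.adicCompletion ℚ)) (localPoints W (v.adicCompletion ℚ))
  let Aₙ : AddSubgroup (localPoints W (v.adicCompletion ℚ)) := red₀.ker ⊓ FixedPoints.addSubgroup (localSubgroup (κ.layerSubgroup n) (v.adicCompletion ℚ)) (localPoints W (v.adicCompletion ℚ))
  have hM₁s : ∀ a, a ∈ M₁s ↔ a ∈ red₀.ker ∧ ∀ h ∈ (localSubgroup κ.kerSubgroup (v.adicCompletion ℚ)), h • a = a := fun a ↦ by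
    change a ∈ red₀.ker ⊓ FixedPoints.addSubgroup (localSubgroup κ.kerSubgroup (v.adicCompletion ℚ)) (localPoints W (v.adicCompletion ℚ)) ↔ _
    rw [AddSubgroup.mem_inf, FixedPoints.mem_addSubgroup]
    exact ⟨fun ⟨h1, h2⟩ ↦ ⟨h1, fun σ hσ ↦ h2 ⟨σ, hσ⟩⟩, fun ⟨h1, h2⟩ ↦ ⟨h1, fun σ ↦ h2 σ σ.2⟩⟩
  have hAₙ : ∀ a, a ∈ Aₙ ↔ a ∈ red₀.ker ∧ ∀ σ ∈ (localSubgroup (κ.layerSubgroup n) (v.adicCompletion ℚ)), σ • a = a := fun a ↦ by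
    change a ∈ red₀.ker ⊓ FixedPoints.addSubgroup (localSubgroup (κ.layerSubgroup n) (v.adicCompletion ℚ)) (localPoints W (v.adicCompletion ℚ)) ↔ _
    rw [AddSubgroup.mem_inf, FixedPoints.mem_addSubgroup]
    exact ⟨fun ⟨h1, h2⟩ ↦ ⟨h1, fun σ hσ ↦ h2 ⟨σ, hσ⟩⟩, fun ⟨h1, h2⟩ ↦ ⟨h1, fun σ ↦ h2 σ σ.2⟩⟩
  have hkst : ∀ (σ : absoluteGaloisGroup (v.adicCompletion ℚ)) (a : (localPoints W (v.adicCompletion ℚ))), a ∈ red₀.ker → σ • a ∈ red₀.ker :=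
    fun σ a ha ↦ (AddMonoidHom.mem_ker).mpr (hstab σ a ((AddMonoidHom.mem_ker).mp ha))
  -- `D₁ = g − 1` on `M₁`
  let D₁ : M₁s →+ M₁s :=
    { toFun := fun a ↦ ⟨g • (a : (localPoints W (v.adicCompletion ℚ))) - a, ⟨red₀.ker.sub_mem (hkst g a a.2.1) a.2.1,
        (subOne (localSubgroup κ.kerSubgroup (v.adicCompletion ℚ)) (localPoints W (v.adicCompletion ℚ)) g ⟨(a : (localPoints W (v.adicCompletion ℚ))), a.2.2⟩).2⟩⟩
      map_zero' := Subtype.ext (by simp)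
      map_add' := fun a b ↦ Subtype.ext (by
        simp only [AddSubgroup.coe_add, smul_add]
        abel) }
  have hD₁ : ∀ a : M₁s, ((D₁ a : M₁s) : (localPoints W (v.adicCompletion ℚ))) = g • (a : (localPoints W (v.adicCompletion ℚ))) - a := fun _ ↦ rfl
  -- `Z = ℤ/2 ≅ A₁[2] = {0, P₁}`
  have hf₁ : (zmultiplesHom (localPoints W (v.adicCompletion ℚ)) P₁) (2 : ℤ) = 0 := by
    change (2 : ℤ) • P₁ = 0
    rw [show (2 : ℤ) = ((2 : ℕ) : ℤ) from rfl, natCast_zsmul]; exact hP₁two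
  let ιZ : ZMod 2 →+ (localPoints W (v.adicCompletion ℚ)) := ZMod.lift 2 ⟨zmultiplesHom (localPoints W (v.adicCompletion ℚ)) P₁, hf₁⟩
  have hιZ0 : ιZ 0 = 0 := map_zero ιZ
  have hιZ1 : ιZ 1 = P₁ := by
    have h := ZMod.lift_coe 2 ⟨zmultiplesHom (localPoints W (v.adicCompletion ℚ)) P₁, hf₁⟩ 1
    rw [Int.cast_one] at h
    exact h.trans (one_zsmul P₁)
  have hZcases : ∀ z : ZMod 2, z = 0 ∨ z = 1 := fun z ↦ by
    fin_cases z
    · exact Or.inl rfl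
    · exact Or.inr rfl
  have hιZinj : Function.Injective ιZ := by
    refine (injective_iff_map_eq_zero ιZ).mpr fun z hz ↦ ?_
    rcases hZcases z with rfl | rfl
    · rfl
    · rw [hιZ1] at hz; exact absurd hz hP₁ne
  have hZr : ∀ a : (localPoints W (v.adicCompletion ℚ)), a ∈ red₀.ker ∧ 2 • a = 0 ↔ a ∈ ιZ.range := by
    intro a
    constructor
    · rintro ⟨ha, h2a⟩
      rcases hA12 a ((AddMonoidHom.mem_ker).mp ha) h2a with rfl | rfl
      · exact ⟨0, hιZ0⟩
      · exact ⟨1, hιZ1⟩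
    · rintro ⟨z, rfl⟩
      rcases hZcases z with rfl | rfl
      · rw [hιZ0]; exact ⟨zero_mem _, smul_zero 2⟩
      · rw [hιZ1]; exact ⟨(AddMonoidHom.mem_ker).mpr hP₁0, hP₁two⟩
  have hZfix : ∀ (σ : absoluteGaloisGroup (v.adicCompletion ℚ)) (z : ZMod 2), σ • ιZ z = ιZ z := fun σ z ↦ by
    rcases hZcases z with rfl | rfl
    · rw [hιZ0]; exact smul_zero σ
    · rw [hιZ1]; exact hP₁fix σ
  -- G3 (Kummer count) with G5 (EP count): `#(M₁/(g−1))[2] · #(Aₙ/2) ≤ #Hom(H_n, ℤ/2) ≤ 2^(2^n+2)`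
  obtain ⟨hfinHom, hHom⟩ := natCard_contHom_zmod_two_layer_le hκ v h2v n
  haveI := hfinHom
  have hdiv₁' : ∀ a ∈ red₀.ker, ∃ b ∈ red₀.ker, 2 • b = a := fun a ha ↦ by
    obtain ⟨b, hb, hba⟩ := hdiv₁ a ((AddMonoidHom.mem_ker).mp ha)
    exact ⟨b, (AddMonoidHom.mem_ker).mpr hb, hba⟩
  obtain ⟨hfinM₁, -, hG3⟩ := natCard_torsionBy_coinv_mul_card_quotient_le_card_contHom hκ v h2v W n hgn hgen
    red₀.ker hkst hdiv₁' ιZ hιZinj hZr hZfix M₁s hM₁s D₁ hD₁ Aₙ hAₙ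
  -- G6c (Lutz at the layer): `#(Aₙ/2) = #(ℤ_v/2)^[L_n:ℚ_v] · #Aₙ[2]`, `[L_n:ℚ_v] = 2^n`, `#(ℤ_v/2) = 2`, `#Aₙ[2] ≥ 2`
  haveI := MultTowerNS2.finiteDimensional_fixedField_localSubgroup_layerSubgroup (κ := κ) v n
  have hfr := MultTowerNS2.finrank_fixedField_localSubgroup_layerSubgroup hκ v h2v n
  haveI hVL : (W.baseChange (IntermediateField.fixedField (localSubgroup (κ.layerSubgroup n) (v.adicCompletion ℚ)) : IntermediateField (v.adicCompletion ℚ) (AlgebraicClosure (v.adicCompletion ℚ)))).IsIntegral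
      (w.comap (algebraMap (IntermediateField.fixedField (localSubgroup (κ.layerSubgroup n) (v.adicCompletion ℚ)) : IntermediateField (v.adicCompletion ℚ) (AlgebraicClosure (v.adicCompletion ℚ))) (AlgebraicClosure (v.adicCompletion ℚ)))).integer := by
    refine ⟨⟨(integralModelInt W).map (algebraMap ℤ _), ?_⟩⟩
    conv_lhs => rw [← map_integralModelInt W]
    rw [baseChange, baseChange, WeierstrassCurve.map_map, WeierstrassCurve.map_map]
    congr 1
    exact RingHom.ext_int _ _
  have hAH : ∀ Q : (localPoints W (v.adicCompletion ℚ)), Q ∈ Aₙ ↔ (Q : (W.baseChange (AlgebraicClosure (v.adicCompletion ℚ))).toAffine.Point) ∈ kernel w (W.baseChange (AlgebraicClosure (v.adicCompletion ℚ))) ∧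
      ∀ σ ∈ (localSubgroup (κ.layerSubgroup n) (v.adicCompletion ℚ)), σ • Q = Q := fun Q ↦ by
    rw [hAₙ, AddMonoidHom.mem_ker, W.localRed_eq_zero_iff_mem_kernel hΔu red₀ hred₀ Q]
  obtain ⟨-, hfinker, hLutz⟩ := natCard_quotient_nsmul_fixedKernel_eq (K := ℚ) (v := v) hw h2v W (localSubgroup (κ.layerSubgroup n) (v.adicCompletion ℚ)) Aₙ hAH
  have hO2 : Nat.card (v.adicCompletionIntegers ℚ ⧸ Ideal.span {((2 : ℕ) : v.adicCompletionIntegers ℚ)}) = 2 := by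
    rw [← (IsDiscreteValuationRing.irreducible_iff_uniformizer _).mp hϖ]
    change Nat.card (IsLocalRing.ResidueField (v.adicCompletionIntegers ℚ)) = 2
    rw [natCard_residueField_adicCompletionIntegers v, Rat.HeightOneSpectrum.primesEquiv_eq_of_natCast_mem v Nat.prime_two h2v]
  haveI := hfinker
  have hker2 : 2 ≤ Nat.card (nsmulAddMonoidHom 2 : Aₙ →+ Aₙ).ker := by
    have hP₁A : P₁ ∈ Aₙ := (hAₙ P₁).mpr ⟨(AddMonoidHom.mem_ker).mpr hP₁0, fun σ _ ↦ hP₁fix σ⟩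
    have hP₁k : (⟨P₁, hP₁A⟩ : Aₙ) ∈ (nsmulAddMonoidHom 2 : Aₙ →+ Aₙ).ker := by
      rw [AddMonoidHom.mem_ker, nsmulAddMonoidHom_apply]; exact Subtype.ext hP₁two
    haveI : Nontrivial (nsmulAddMonoidHom 2 : Aₙ →+ Aₙ).ker :=
      ⟨⟨0, ⟨⟨P₁, hP₁A⟩, hP₁k⟩, fun h ↦ hP₁ne (congrArg (fun x ↦ ((x.1 : Aₙ) : (localPoints W (v.adicCompletion ℚ)))) h).symm⟩⟩
    exact Finite.one_lt_card
  have hc₁ : Nat.card {c : M₁s ⧸ D₁.range // 2 • c = 0} ≤ 2 := by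
    rw [hLutz, hO2, hfr] at hG3
    have h4 : (2 : ℕ) ^ (2 ^ n + 2) = 2 ^ 2 ^ n * 4 := by rw [pow_add]; norm_num
    have h := hG3.trans (hHom.trans h4.le)
    have hpos : 0 < (2 : ℕ) ^ 2 ^ n := by positivity
    have h1 : Nat.card {c : M₁s ⧸ D₁.range // 2 • c = 0} * 2 * 2 ^ 2 ^ n ≤ 4 * 2 ^ 2 ^ n :=
      calc Nat.card {c : M₁s ⧸ D₁.range // 2 • c = 0} * 2 * 2 ^ 2 ^ n
          ≤ Nat.card {c : M₁s ⧸ D₁.range // 2 • c = 0} *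
              Nat.card (nsmulAddMonoidHom 2 : Aₙ →+ Aₙ).ker * 2 ^ 2 ^ n := by gcongr
        _ = Nat.card {c : M₁s ⧸ D₁.range // 2 • c = 0} *
              (2 ^ 2 ^ n * Nat.card (nsmulAddMonoidHom 2 : Aₙ →+ Aₙ).ker) := by ring
        _ ≤ 2 ^ 2 ^ n * 4 := h
        _ = 4 * 2 ^ 2 ^ n := by ring
    have h2 := Nat.le_of_mul_le_mul_right h1 hpos
    omega
  haveI := hfinM₁
  -- G1-ε (the refined dévissage along `red₀`) on `M = E(K̄_v)^{H_∞}`, `D = g − 1`, with `hε` = the ε-step (BRICK ε4)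
  have hlift : ∀ x : FixedPoints.addSubgroup (localSubgroup κ.kerSubgroup (v.adicCompletion ℚ)) (localPoints W (v.adicCompletion ℚ)), ∃ x₀ : FixedPoints.addSubgroup (localSubgroup κ.kerSubgroup (v.adicCompletion ℚ)) (localPoints W (v.adicCompletion ℚ)),
      subOne (localSubgroup κ.kerSubgroup (v.adicCompletion ℚ)) (localPoints W (v.adicCompletion ℚ)) g x₀ = 0 ∧ (red₀.comp (FixedPoints.addSubgroup (localSubgroup κ.kerSubgroup (v.adicCompletion ℚ)) (localPoints W (v.adicCompletion ℚ))).subtype) x₀ =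
        (red₀.comp (FixedPoints.addSubgroup (localSubgroup κ.kerSubgroup (v.adicCompletion ℚ)) (localPoints W (v.adicCompletion ℚ))).subtype) x := fun x ↦ by
    have hτx : τ • (x : (localPoints W (v.adicCompletion ℚ))) = x := (FixedPoints.mem_addSubgroup _ _ _).mp x.2 ⟨τ, hτHi⟩
    obtain ⟨P₀, hP₀fix, hP₀⟩ := exists_fixed_localRed_eq W hw hΔu red₀ hred₀ h2v hΔ h𝔐 hτ (x : (localPoints W (v.adicCompletion ℚ))) (by rw [hτx])
    refine ⟨⟨P₀, (FixedPoints.mem_addSubgroup _ _ _).mpr fun σ ↦ hP₀fix σ⟩, Subtype.ext ?_, ?_⟩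
    · rw [coe_subOne_apply, hP₀fix, sub_self]; rfl
    · simpa using hP₀
  have hrj : ∀ y : FixedPoints.addSubgroup (localSubgroup κ.kerSubgroup (v.adicCompletion ℚ)) (localPoints W (v.adicCompletion ℚ)), (red₀.comp (FixedPoints.addSubgroup (localSubgroup κ.kerSubgroup (v.adicCompletion ℚ)) (localPoints W (v.adicCompletion ℚ))).subtype) y = 0 →
      ∃ x : M₁s, AddSubgroup.inclusion (inf_le_right : M₁s ≤ FixedPoints.addSubgroup (localSubgroup κ.kerSubgroup (v.adicCompletion ℚ)) (localPoints W (v.adicCompletion ℚ))) x = y :=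
    fun y hy ↦ ⟨⟨y, ⟨(AddMonoidHom.mem_ker).mpr hy, y.2⟩⟩, rfl⟩
  have hD₁j : ∀ x : M₁s, AddSubgroup.inclusion (inf_le_right : M₁s ≤ FixedPoints.addSubgroup (localSubgroup κ.kerSubgroup (v.adicCompletion ℚ)) (localPoints W (v.adicCompletion ℚ))) (D₁ x) =
      subOne (localSubgroup κ.kerSubgroup (v.adicCompletion ℚ)) (localPoints W (v.adicCompletion ℚ)) g (AddSubgroup.inclusion (inf_le_right : M₁s ≤ FixedPoints.addSubgroup (localSubgroup κ.kerSubgroup (v.adicCompletion ℚ)) (localPoints W (v.adicCompletion ℚ))) x) :=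
    fun x ↦ Subtype.ext rfl
  -- THE ε-STEP: every `2`-torsion coinvariant class of `M = E(K̄_v)^{H_∞}` reduces to `0`
  have hε : ∀ x y : FixedPoints.addSubgroup (localSubgroup κ.kerSubgroup (v.adicCompletion ℚ)) (localPoints W (v.adicCompletion ℚ)),
      2 • x = subOne (localSubgroup κ.kerSubgroup (v.adicCompletion ℚ)) (localPoints W (v.adicCompletion ℚ)) g y →
        (red₀.comp (FixedPoints.addSubgroup (localSubgroup κ.kerSubgroup (v.adicCompletion ℚ)) (localPoints W (v.adicCompletion ℚ))).subtype) x = 0 := by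
    intro x y hxy
    have hxi : ∀ h ∈ localSubgroup κ.kerSubgroup (v.adicCompletion ℚ), h • (x : localPoints W (v.adicCompletion ℚ)) = x :=
      fun h hh ↦ (FixedPoints.mem_addSubgroup _ _ _).mp x.2 ⟨h, hh⟩
    have hyi : ∀ h ∈ localSubgroup κ.kerSubgroup (v.adicCompletion ℚ), h • (y : localPoints W (v.adicCompletion ℚ)) = y :=
      fun h hh ↦ (FixedPoints.mem_addSubgroup _ _ _).mp y.2 ⟨h, hh⟩
    have hrel : 2 • (x : localPoints W (v.adicCompletion ℚ)) = g • (y : localPoints W (v.adicCompletion ℚ)) - y := by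
      have h := congrArg (fun z : FixedPoints.addSubgroup (localSubgroup κ.kerSubgroup (v.adicCompletion ℚ)) (localPoints W (v.adicCompletion ℚ)) ↦ (z : localPoints W (v.adicCompletion ℚ))) hxy
      simpa only [AddSubgroup.coe_nsmul, coe_subOne_apply] using h
    rw [AddMonoidHom.comp_apply, AddSubgroup.coe_subtype]
    exact localRed_eq_zero_of_two_nsmul_eq_smul_sub W hgo hΔ8' κ hκ v h2v n hw red₀ hred₀ hgI hgn hgen hxi hyi hrel
  obtain ⟨hfinM, hG1⟩ := natCard_torsionBy_quotient_le_of_invariant_of_red_eq_zero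
    (subOne (localSubgroup κ.kerSubgroup (v.adicCompletion ℚ)) (localPoints W (v.adicCompletion ℚ)) g)
    (red₀.comp (FixedPoints.addSubgroup (localSubgroup κ.kerSubgroup (v.adicCompletion ℚ)) (localPoints W (v.adicCompletion ℚ))).subtype) hlift
    (AddSubgroup.inclusion (inf_le_right : M₁s ≤ FixedPoints.addSubgroup (localSubgroup κ.kerSubgroup (v.adicCompletion ℚ)) (localPoints W (v.adicCompletion ℚ))))
    (AddSubgroup.inclusion_injective _) hrj D₁ hD₁j 2 hε
  -- BRICK 11: `𝒦_{v,n}[2^∞][2] ↪ (M/(g−1)M)[2]`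
  haveI := hfinM
  obtain ⟨hfinK, hK⟩ := MultTowerNS2.finite_torsionBy_localTowerKerPrimary_and_card_le W κ (v.adicCompletion ℚ) n hgn hgen 2
  exact ⟨hfinK, hK.trans (hG1.trans hc₁)⟩

/-- **IMC-LKε⁻≤ (`F1Sign2.LocalKernelOneBitOffNormAtTwoLe`, cell `bsd-f1-sign2`, tree p599820) PROVED**: for every
globally minimal `W/ℚ`, good ordinary at `2`, with `Δ_W ≡ ±3 (mod 8)`, and every layer `n`: `#𝒦_{v,n}[2^∞][2] ≤ 2` at the
place(s) `v ∋ 2` (with finiteness). The named statement consumed by the ε-door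
`F1Sign2.hC_at_two_of_oneBitLe` / the 71 generated ε-door class sections (MEMO-imc §10.43) is hereby a theorem with NO binder.
[cite: GreenbergLNM1716, §3 Lemma 3.4 (proof, p. 89)] [cite: Kramer1981, §2 Prop. 5 (p. 127)] -/
theorem localKernelOneBitOffNormAtTwoLe_holds : LocalKernelOneBitOffNormAtTwoLe :=
  fun W _ _ hord hΔ8 n κ hκ v hv ↦
    pTorsion_localTowerKer_at_two_le_two_kernel_of_discNonNorm W hord hΔ8 κ hκ v hv n

end Summit.BirchSwinnertonDyer.BirchSwinnertonDyer.Theorems.GoodOrdTower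

end
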